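import Summits.HodgeConjecture.HodgeConjecture.Theorems.MarkmanPartnerTransportPicardThreeK3SquaresOneCycleOddPicard
import Summits.HodgeConjecture.HodgeConjecture.Theorems.MarkmanPartnerTransportPicardThreeK3SquaresOneCycleDegree
import Summits.HodgeConjecture.HodgeConjecture.Theorems.MarkmanPartnerTransportPicardThreeK3SquaresQuarticRigidity
import Summits.HodgeConjecture.HodgeConjecture.Theorems.MarkmanPartnerTransportPicardThreeK3SquaresRMSpreadOfCycleInduced
import Summits.HodgeConjecture.HodgeConjecture.Theorems.MarkmanPartnerTransportHilbertSquareOfRMSpread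

/-!
# Route MarkmanPartnerTransport · «QUARTIC SOCKET» (chapter ROUTE-P1AL, cell `(3,4)` at `ρ(S) = 2`): no CM, generation,
# `IsCycleInducedRMK3 S 2 P`, HC⁴(S × S) and HC⁴(S^{[2]}) from ONE endomorphism with a totally real QUARTIC eigenvalue

Planner p1 g39 (TARGET «QUARTIC-SOCKET», 2026-08-28T16:26:10Z), prover seat hodge-nonav-19716-p2 (gen 7); the surface
reading of `…PicardThreeK3SquaresQuarticRigidity` and the `ρ(S) = 2` sibling of `…PicardThreeK3SquaresHeckeSpread`
(`ρ(S) = 1`). For a projective K3 surface `S` with `ρ(S) = 2` and ONE rational, type-preserving endomorphism `e` of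
`H²(S(ℂ); ℂ)` whose eigenvalue `ev` on a non-zero `(2,0)`-class has `deg minpoly_ℚ ev = 4` with ALL CONJUGATES REAL
(the load-bearing hypothesis: at rank `20` a quartic eigenvalue of CM type does occur):

* `not_hasComplexMultiplication_of_picard_two_of_totallyReal_quartic` — **no CM** (markings only): the marking picture of
  `OneCycle.not_hasComplexMultiplication_of_odd_picard`, odd-rank step replaced by QUARTIC RIGIDITY (`8 ∤ 20`);
* `transcendentalEndomorphismsGeneratedBy_of_picard_two_of_totallyReal_quartic` — **`e` GENERATES `End_Hdg T(S)`**
  (degree form of ONE CYCLE SUFFICES at `k = 4`: `4 · j · m + 2 ≠ 22`); `isCycleInducedRMK3_two_of_totallyReal_quartic_cycle`;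
* `hodgeConjectureFor_square_of_totallyReal_quartic_cycle_picard_two` — **HC⁴(S ⊗ S)**, markings only;
  `hodgeConjectureFor_hilbertSquare_of_totallyReal_quartic_cycle_picard_two` — **HC⁴ of every Hilbert square `S^{[2]}`**
  (the cell-`(3,4)` fourfolds), mod {markings, Beauville}.

With `…HeckeSpread` (`ρ = 1`) all three odd K3-cells of crux #5 are «existence only». CONDITIONAL on the existence of
the endomorphism; no definition, no sorry, no new named fact; nothing here proves the crux or HC; rung F-H1 not moved.
`--supports stmt-HodgeConjecture-19652`. References: van Geemen–Schütt, Forum Math. Sigma 13 (2025) e2, Thm. 3.19,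
§4.8; van Geemen, Michigan Math. J. 56 (2008) Lemma 3.2; Huybrechts, *Lectures on K3 Surfaces*, Ch. 3 §3.5, Rem. 3.3.14;
Beauville, J. Differential Geom. 18 (1983) §6.
-/

set_option linter.dupNamespace false

noncomputable section

namespace Summit.HodgeConjecture.HodgeConjecture.Theorems.MarkmanPartnerTransport.QuarticSocket

open scoped Manifold TensorProduct
open Module CategoryTheory MonoidalCategory CartesianMonoidalCategory Polynomial AlgebraicGeometry
open Literature.AlgebraicGeometry Literature.AlgebraicGeometry.Motives Literature.AlgebraicGeometry.HodgeTheory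
open Literature.AlgebraicGeometry.Motives.HodgeStructure
open Literature.AlgebraicGeometry.Surfaces Literature.AlgebraicGeometry.HilbertScheme
open Literature.AlgebraicTopology.SingularHomology
open Summit.HodgeConjecture.HodgeConjecture.Theorems
open Summit.HodgeConjecture.HodgeConjecture.Theorems.NikulinTwinTransport
open Summit.HodgeConjecture.HodgeConjecture.Theorems.AnchorExistenceCMFloor
open Summit.HodgeConjecture.HodgeConjecture.Theorems.MarkmanPartnerTransport
open Summit.HodgeConjecture.HodgeConjecture.Theorems.MarkmanPartnerTransport.RealMultiplicationRanks
open Summit.HodgeConjecture.HodgeConjecture.Theorems.MarkmanPartnerTransport.OneCycle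
open Summit.HodgeConjecture.HodgeConjecture.Theorems.MarkmanPartnerTransport.QuarticRigidity
open Summit.HodgeConjecture.HodgeConjecture.Theorems.MarkmanPartnerTransport.PartnerLattice

variable {S H : SchemeOver ℂ} {Ξ : (S ⊗ H).left.IdealSheafData}

/-- `Corr[hS ; γ, y] = fst_*(snd^* y ∪ γ)`, complex orientations. Local notation only. -/
local notation3 (prettyPrint := false) "Corr[" hS " ; " γ ", " y "]" =>
  complexGysin complexOrientationFamily (IsSmoothProjective.tensor_holds hS hS) hS
    (SemiCartesianMonoidalCategory.fst _ _) (rfl : 2 * 1 + 2 * 2 + 2 * 2 = 2 * 1 + 2 * (2 + 2))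
    (cupProduct (rfl : 2 * 1 + 2 * 2 = 2 * 1 + 2 * 2)
      (complexBetti.map (SemiCartesianMonoidalCategory.snd _ _) (2 * 1) y) γ)

/-! ### No complex multiplication at `ρ(S) = 2` with a totally real quartic endomorphism -/
/-- **A projective K3 surface with `ρ(S) = 2` carrying a rational type-preserving endomorphism with a TOTALLY REAL QUARTIC
`(2,0)`-eigenvalue has no CM** (markings): a CM endomorphism `e` (`Im ev ≠ 0`) and the quartic `e'` both restrict into
`E = End_Hdg(T)` (rank `20`) with `ε(e|_T) = ev`, `ε(e'|_T) = ev'`; `e'|_T` has degree `4` and real conjugates, so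
QUARTIC RIGIDITY makes every embedding of `E` real — contradiction. Marking picture VERBATIM from
`OneCycle.not_hasComplexMultiplication_of_odd_picard`. [cite: Huybrechts2016K3, Ch. 3 §3.5, Rem. 3.3.14 (ii) and (3.2)]
[cite: Vangeemen2008, Lemma 3.2] [cite: Zarhin1983HodgeGroupsK3, Thm. 1.5.1] -/
theorem not_hasComplexMultiplication_of_picard_two_of_totallyReal_quartic (hmark : Huybrechts_K3_marking_exists)
    (hS : IsK3Surface S) (hρ : Module.finrank ℂ ↥(algebraicClasses S 1) = 2)
    (e' : complexBetti S (2 * 1) →ₗ[ℂ] complexBetti S (2 * 1))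
    (he'_rat : ∀ y, IsRationalClass y → IsRationalClass (e' y))
    (he'_typ : ∀ (i j : ℕ) y, IsOfHodgeType 2 S (2 * 1) i j y → IsOfHodgeType 2 S (2 * 1) i j (e' y))
    (he'_ev : ∃ (σ₁ : complexBetti S (2 * 1)) (ev' : ℂ), IsOfHodgeType 2 S (2 * 1) 2 0 σ₁ ∧ σ₁ ≠ 0 ∧
      e' σ₁ = ev' • σ₁ ∧ (minpoly ℚ ev').natDegree = 4 ∧
      ∀ z : ℂ, Polynomial.aeval z (minpoly ℚ ev') = 0 → starRingEnd ℂ z = z) :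
    ¬ HasComplexMultiplication S := by
  intro hCMS
  obtain ⟨e, he_rat, he_typ, σ₀, ev, hσ₀20, hσ₀ne, hev, heσ₀⟩ := hCMS
  obtain ⟨σ₁, ev', hσ₁20, hσ₁ne, he'σ₁, hdeg, htr⟩ := he'_ev
  classical
  have hHT : Huybrechts_K3_hodgeTypes_H2 := Huybrechts_K3_hodgeTypes_H2_holds
  obtain ⟨η, p₀, x, hp₀, ⟨hp₀int, hp₀gen, hηint, hηcup, hx20, hx20'⟩, hxx, hxpos, hu⟩ := hmark S hS
  set N := algebraicClasses S 1 with hNdef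
  set σ := η.symm x with hσdef
  have hησ : η σ = x := by rw [hσdef, LinearEquiv.apply_symm_apply]
  have hxne : σ ≠ 0 := by
    intro h0
    have hx : x = 0 := by rw [← hησ, h0, map_zero]
    subst hx
    simp [k3Form] at hxpos
  have hxne' : x ≠ 0 := fun h => hxne (by rw [hσdef, h, map_zero])
  obtain ⟨h₁, -, h₃⟩ := hHT S hS σ hx20 hxne
  have hσbar : conjClass (ComplexPoints S) (2 * 1) σ = η.symm (star x) := conjClass_marking_symm η hηint x
  have hsmul0 : ∀ {c : ℂ}, c • p₀ = 0 → c = 0 := fun h => by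
    rcases smul_eq_zero.1 h with h | h
    · exact h
    · exact absurd h hp₀
  have hL11 : ∀ c : complexBetti S (2 * 1), IsRationalClass c → IsOfHodgeType 2 S (2 * 1) 1 1 c → c ∈ N :=
    fun c hc h11 => lefschetzOneOne_rational_holds hS.1 c hc h11
  have hND : ∀ c ∈ N, IsRationalClass c →
      (∀ d ∈ N, cupProduct (rfl : 2 * 1 + 2 * 1 = 2 * 2) c d = 0) → c = 0 :=
    fun c hcN hc hperp => anchorExistence_cmFloor_divisorClass_eq_zero_of_hodgeIndex
      hodgeIndex_surface_holds lefschetzOneOne_rational_holds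
      Grothendieck1969_supportedClasses_le_hodgeConiveau_holds hS hcN hc hperp
  -- the eigenvalue of `e` on `σ`
  have heσ : e σ = ev • σ := by
    obtain ⟨t, ht⟩ := hx20' σ₀ hσ₀20
    have ht0 : t ≠ 0 := by
      rintro rfl
      rw [zero_smul] at ht
      exact hσ₀ne ht
    have h := heσ₀
    rw [ht, map_smul, smul_comm] at h
    exact smul_right_injective _ ht0 h
  -- the eigenvalue of `e'` on `σ`
  have he'σ : e' σ = ev' • σ := by
    obtain ⟨t, ht⟩ := hx20' σ₁ hσ₁20
    have ht0 : t ≠ 0 := by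
      rintro rfl
      rw [zero_smul] at ht
      exact hσ₁ne ht
    have h := he'σ₁
    rw [ht, map_smul, smul_comm] at h
    exact smul_right_injective _ ht0 h
  -- rational classes are `Λ_ℚ`
  have hrat : ∀ c, IsRationalClass c ↔ ∃ w : K3Index → ℚ, η c = fun i => (w i : ℂ) :=
    isRationalClass_iff_of_marking hS η hηint
  -- the rational points of `N`
  let NQ : Submodule ℚ (K3Index → ℚ) :=
    { carrier := {u | η.symm (fun j => (u j : ℂ)) ∈ N}
      add_mem' := fun {u v} hu hv => by
        simp only [Set.mem_setOf_eq, ratCastΛ_add, map_add]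
        exact N.add_mem hu hv
      zero_mem' := by
        simp only [Set.mem_setOf_eq, ratCastΛ_zero, map_zero]
        exact N.zero_mem
      smul_mem' := fun q u hu => by
        simp only [Set.mem_setOf_eq, ratCastΛ_smul, map_smul]
        exact N.smul_mem _ hu }
  have memNQ : ∀ u, u ∈ NQ ↔ η.symm (fun j => (u j : ℂ)) ∈ N := fun u => Iff.rfl
  -- `(1,1)`-classes through the marking
  have h11_iff : ∀ v : K3Index → ℂ, IsOfHodgeType 2 S (2 * 1) 1 1 (η.symm v) ↔
      (k3Form v x = 0 ∧ k3Form v (star x) = 0) := by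
    intro v
    rw [h₃ (η.symm v), hηcup, hηcup, LinearEquiv.apply_symm_apply, hησ, hσbar, LinearEquiv.apply_symm_apply]
    constructor
    · rintro ⟨ha, hb⟩
      exact ⟨hsmul0 ha, hsmul0 hb⟩
    · rintro ⟨ha, hb⟩
      rw [ha, hb, zero_smul]
      exact ⟨rfl, rfl⟩
  -- `N_ℚ = Λ_ℚ ∩ {x, x̄}^⊥`
  have hN : ∀ u : K3Index → ℚ, u ∈ NQ ↔
      (k3Form (fun i => (u i : ℂ)) x = 0 ∧ k3Form (fun i => (u i : ℂ)) (star x) = 0) := by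
    intro u
    rw [memNQ, ← h11_iff]
    constructor
    · intro hu
      exact isOfHodgeType_of_mem_algebraicClasses_of_isSmoothProjective hS.1 1 hu
    · intro hu
      exact hL11 _ ((hrat _).2 ⟨u, LinearEquiv.apply_symm_apply _ _⟩) hu
  -- `N` is spanned by its rational classes, so `N_ℚ^⊥ ⊗ ℂ ⊥ N`
  have hspan := span_isRationalClass_eq_top_of_isSmoothProjective_holds.supportedClasses_eq_span
    hS.1 (2 * 1) 1
  have horth : ∀ u ∈ k3FormRat.orthogonal NQ, ∀ d ∈ N, k3Form (fun j => (u j : ℂ)) (η d) = 0 := by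
    intro u hu d hd
    rw [LinearMap.BilinForm.mem_orthogonal_iff] at hu
    have hd' : d ∈ Submodule.span ℂ {c : complexBetti S (2 * 1) |
        IsRationalClass c ∧ c ∈ supportedClasses S (2 * 1) 1} := by
      rw [← hspan]; exact hd
    clear hd
    induction hd' using Submodule.span_induction with
    | mem d hd =>
      obtain ⟨w, hw⟩ := (hrat d).1 hd.1
      have hwN : w ∈ NQ := by
        rw [memNQ, ← hw, LinearEquiv.symm_apply_apply]
        exact hd.2
      rw [hw, k3Form_ratCast, k3FormRat_isSymm.eq, hu w hwN, Rat.cast_zero]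
    | zero => rw [map_zero, k3Form_zero_right]
    | add c c' _ _ hc hc' => rw [map_add, k3Form_add_right, hc, hc', add_zero]
    | smul t c _ hc => rw [map_smul, k3Form_smul_right, hc, mul_zero]
  -- `N_ℚ ∩ N_ℚ^⊥ = 0` (Hodge index)
  have hdisj : Disjoint NQ (k3FormRat.orthogonal NQ) := by
    rw [Submodule.disjoint_def]
    intro u huN huT
    have hc0 : η.symm (fun j => (u j : ℂ)) = 0 :=
      hND _ ((memNQ u).1 huN) ((hrat _).2 ⟨u, LinearEquiv.apply_symm_apply _ _⟩) fun d hd => by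
        rw [hηcup, LinearEquiv.apply_symm_apply, horth u huT d hd, zero_smul]
    apply ratCastΛ_injective
    rw [ratCastΛ_zero]
    exact η.symm.injective (hc0.trans (map_zero _).symm)
  have hc := isCompl_orthogonal hdisj
  -- the transcendental Hodge structure, irreducible of K3 type, polarized; its endomorphism field
  set H := hodgeT hN hdisj hxx hxpos with hH
  have hK3 : H.IsOfK3Type := isOfK3Type_hodgeT hN hdisj hxx hxpos
  have hirr : H.IsIrreducible := isIrreducible_hodgeT hN hdisj hxx hxpos
  set ψ : H.Polarization := polT hN hdisj hxx hxpos hu with hψ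
  obtain ⟨-, ε, hεinj, hε⟩ := Zarhin1983_endAlg_isField_holds H hirr hK3
  have hω : omega x hdisj ∈ H.piece 2 0 := (mem_piece_two_zero_ofPeriod _ _).2 ⟨1, one_smul _ _⟩
  -- reading a rational type-preserving endomorphism of `H²(S)` in `E = End_Hdg(T)`
  have read : ∀ (G : complexBetti S (2 * 1) →ₗ[ℂ] complexBetti S (2 * 1)),
      (∀ y, IsRationalClass y → IsRationalClass (G y)) →
      (∀ (i j : ℕ) y, IsOfHodgeType 2 S (2 * 1) i j y → IsOfHodgeType 2 S (2 * 1) i j (G y)) →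
      ∃ (φ : Module.End ℚ (K3Index → ℚ)) (hφT : ∀ t ∈ k3FormRat.orthogonal NQ,
          φ t ∈ k3FormRat.orthogonal NQ),
        cxEnd φ = η.toLinearMap ∘ₗ G ∘ₗ η.symm.toLinearMap ∧ φ.restrict hφT ∈ H.endAlg := by
    intro G hG_rat hG_typ
    obtain ⟨φ, hφM, hφx, hφ11⟩ := anchorExistence_cmFloor_exists_ratEnd hHT hS η p₀ hp₀ hηint hηcup x hx20
      hx20' hxne G hG_rat hG_typ
    have hφT : ∀ t ∈ k3FormRat.orthogonal NQ, φ t ∈ k3FormRat.orthogonal NQ :=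
      fun t ht => map_mem_T hN φ hφx ht
    exact ⟨φ, hφT, hφM, restrict_mem_endAlg hN hdisj hxx hxpos φ hφT hφx hφ11⟩
  -- `dim_ℚ N_ℚ = dim_ℂ N`, hence `dim_ℚ T = 22 - ρ(S)`
  let b := Module.finBasis ℚ NQ
  let c : Fin (Module.finrank ℚ ↥NQ) → complexBetti S (2 * 1) :=
    fun i => η.symm (fun j => (((b i : NQ) : K3Index → ℚ) j : ℂ))
  have hcN : ∀ i, c i ∈ N := fun i => (memNQ _).1 (b i).2
  have hle : N ≤ Submodule.span ℂ (Set.range c) := by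
    intro d hd
    have hd' : d ∈ Submodule.span ℂ {c : complexBetti S (2 * 1) |
        IsRationalClass c ∧ c ∈ supportedClasses S (2 * 1) 1} := by
      rw [← hspan]; exact hd
    refine Submodule.span_le.2 ?_ hd'
    rintro d ⟨hdQ, hdN⟩
    obtain ⟨w, hw⟩ := (hrat d).1 hdQ
    have hwN : w ∈ NQ := by
      rw [memNQ, ← hw, LinearEquiv.symm_apply_apply]
      exact hdN
    have hd_eq : d = η.symm (fun j => (w j : ℂ)) := by rw [← hw, LinearEquiv.symm_apply_apply]
    have hw_eq : (w : K3Index → ℚ) = ∑ i, (b.repr ⟨w, hwN⟩ i) • ((b i : NQ) : K3Index → ℚ) := by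
      have h := congrArg (fun t : NQ => (t : K3Index → ℚ)) (b.sum_repr ⟨w, hwN⟩).symm
      simpa only [Submodule.coe_sum, Submodule.coe_smul] using h
    rw [SetLike.mem_coe, hd_eq, hw_eq, ratCastΛ_sum, map_sum]
    refine Submodule.sum_mem _ fun i _ => ?_
    rw [ratCastΛ_smul, map_smul]
    exact Submodule.smul_mem _ _ (Submodule.subset_span ⟨i, rfl⟩)
  haveI : Module.Finite ℂ ↥(Submodule.span ℂ (Set.range c)) :=
    Module.Finite.span_of_finite ℂ (Set.finite_range c)
  haveI : Module.Finite ℂ ↥N := Submodule.finiteDimensional_of_le hle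
  have hdimN_le : Module.finrank ℂ ↥N ≤ Module.finrank ℚ ↥NQ :=
    (Submodule.finrank_mono hle).trans ((finrank_range_le_card c).trans (by simp))
  have hcind : LinearIndependent ℂ c := by
    rw [Fintype.linearIndependent_iff]
    intro z hz i
    have hB := (Algebra.TensorProduct.basis ℂ b).linearIndependent
    rw [Fintype.linearIndependent_iff] at hB
    refine hB z ?_ i
    apply iota_injective NQ
    rw [map_sum, map_zero]
    have h := congrArg η hz
    rw [map_sum, map_zero] at h
    refine (Finset.sum_congr rfl fun j _ => ?_).trans h
    rw [map_smul, Algebra.TensorProduct.basis_apply, iota_one_tmul, map_smul, LinearEquiv.apply_symm_apply]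
  have hdimN_ge : Module.finrank ℚ ↥NQ ≤ Module.finrank ℂ ↥N := by
    let c' : Fin (Module.finrank ℚ ↥NQ) → ↥N := fun i => ⟨c i, hcN i⟩
    have hcomp : ⇑N.subtype ∘ c' = c := funext fun i => rfl
    have hc' : LinearIndependent ℂ c' := LinearIndependent.of_comp N.subtype (hcomp ▸ hcind)
    simpa using hc'.fintype_card_le_finrank
  have hdimN : Module.finrank ℚ ↥NQ = Module.finrank ℂ ↥N := le_antisymm hdimN_ge hdimN_le
  have hdimΛ : Module.finrank ℚ (K3Index → ℚ) = 22 := by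
    rw [Module.finrank_fintype_fun_eq_card]
    simp [Fintype.card_sum, Fintype.card_fin]
  have hdimT : Module.finrank ℚ ↥(k3FormRat.orthogonal NQ) + Module.finrank ℂ ↥N = 22 := by
    have h := Submodule.finrank_add_eq_of_isCompl hc
    omega
  obtain ⟨φe, hφeT, hφeM, hre⟩ := read e he_rat he_typ
  have hφeMapp : ∀ v, cxEnd φe v = η (e (η.symm v)) := fun v => by rw [hφeM]; rfl
  -- `ε(e|_T) = ev`
  have hεre : ε ⟨φe.restrict hφeT, hre⟩ = ev := by
    have h := hε ⟨φe.restrict hφeT, hre⟩ (omega x hdisj) hω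
    have h2 := congrArg (iota (k3FormRat.orthogonal NQ)) h
    have hval : ((⟨φe.restrict hφeT, hre⟩ : H.endAlg) : Module.End ℚ ↥(k3FormRat.orthogonal NQ)) =
        φe.restrict hφeT := rfl
    rw [hval, iota_baseChange_restrict φe hφeT, iota_omega hN hdisj, map_smul, iota_omega hN hdisj,
      hφeMapp, ← hσdef, heσ, map_smul, hησ] at h2
    have h3 : (ev - ε ⟨φe.restrict hφeT, hre⟩) • x = 0 := by rw [sub_smul, h2, sub_self]
    rcases smul_eq_zero.1 h3 with h4 | h4
    · exact (sub_eq_zero.1 h4).symm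
    · exact absurd h4 hxne'
  -- the quartic endomorphism `e'` read in `E`, with `ε(e'|_T) = ev'`
  obtain ⟨φe', hφe'T, hφe'M, hre'⟩ := read e' he'_rat he'_typ
  have hφe'Mapp : ∀ v, cxEnd φe' v = η (e' (η.symm v)) := fun v => by rw [hφe'M]; rfl
  have hεre' : ε ⟨φe'.restrict hφe'T, hre'⟩ = ev' := by
    have h := hε ⟨φe'.restrict hφe'T, hre'⟩ (omega x hdisj) hω
    have h2 := congrArg (iota (k3FormRat.orthogonal NQ)) h
    have hval : ((⟨φe'.restrict hφe'T, hre'⟩ : H.endAlg) : Module.End ℚ ↥(k3FormRat.orthogonal NQ)) =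
        φe'.restrict hφe'T := rfl
    rw [hval, iota_baseChange_restrict φe' hφe'T, iota_omega hN hdisj, map_smul, iota_omega hN hdisj,
      hφe'Mapp, ← hσdef, he'σ, map_smul, hησ] at h2
    have h3 : (ev' - ε ⟨φe'.restrict hφe'T, hre'⟩) • x = 0 := by rw [sub_smul, h2, sub_self]
    rcases smul_eq_zero.1 h3 with h4 | h4
    · exact (sub_eq_zero.1 h4).symm
    · exact absurd h4 hxne'
  -- rank `20`: `dim_ℚ T = 22 - ρ(S)`
  have h20 : Module.finrank ℚ ↥(k3FormRat.orthogonal NQ) = 20 := by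
    have hN2 : Module.finrank ℂ ↥N = 2 := by rw [hNdef]; exact hρ
    omega
  -- QUARTIC RIGIDITY (eigenvalue form): `E` is totally real — but the CM endomorphism `e` has `ε(e|_T) = ev ∉ ℝ`
  obtain ⟨hreal, -⟩ := totallyReal_and_finrank_eq_four_of_quartic_algHom hirr hK3 ψ h20 ε hεinj
    (r := ⟨φe'.restrict hφe'T, hre'⟩) (by rw [hεre']; exact hdeg) (by rw [hεre']; exact htr)
  have h := hreal ε.toRingHom ⟨φe.restrict hφeT, hre⟩
  change starRingEnd ℂ (ε ⟨φe.restrict hφeT, hre⟩) = ε ⟨φe.restrict hφeT, hre⟩ at h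
  rw [hεre] at h
  exact hev (Complex.conj_eq_iff_im.1 h)

/-! ### Generation, the van Geemen–Schütt shape, HC⁴ for `S × S` and `S^{[2]}` -/

/-- **`4 · j · m + 2 ≠ 22`** for `j ≥ 2`, `m ≥ 3` (p1's `cell34_degree_law`). [folklore] -/
theorem four_mul_mul_add_two_ne {j m : ℕ} (hj : 2 ≤ j) (hm : 3 ≤ m) : 4 * j * m + 2 ≠ 22 := by
  intro h
  nlinarith

/-- **(b) Generation at `ρ(S) = 2` from a totally real quartic eigenvalue** (markings only; degree form of ONE CYCLE
SUFFICES at `k = 4`, CM branch excluded). [cite: Vangeemen2008, Lemma 3.2] [cite: GeemenSchutt2023, §2.1 and Thm. 3.19] -/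
theorem transcendentalEndomorphismsGeneratedBy_of_picard_two_of_totallyReal_quartic
    (hmark : Huybrechts_K3_marking_exists) (hS : IsK3Surface S) (hρ : Module.finrank ℂ ↥(algebraicClasses S 1) = 2)
    (e : complexBetti S (2 * 1) →ₗ[ℂ] complexBetti S (2 * 1))
    (he_rat : ∀ y, IsRationalClass y → IsRationalClass (e y))
    (he_typ : ∀ (i j : ℕ) y, IsOfHodgeType 2 S (2 * 1) i j y → IsOfHodgeType 2 S (2 * 1) i j (e y))
    (he_ev : ∃ (σ₀ : complexBetti S (2 * 1)) (ev : ℂ), IsOfHodgeType 2 S (2 * 1) 2 0 σ₀ ∧ σ₀ ≠ 0 ∧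
      e σ₀ = ev • σ₀ ∧ (minpoly ℚ ev).natDegree = 4 ∧
      ∀ z : ℂ, Polynomial.aeval z (minpoly ℚ ev) = 0 → starRingEnd ℂ z = z) :
    TranscendentalEndomorphismsGeneratedBy S e := by
  obtain ⟨σ₀, ev, hσ₀, hσ₀ne, heσ₀, hdeg, htr⟩ := he_ev
  have hk : ∀ j m : ℕ, 2 ≤ j → 3 ≤ m →
      (minpoly ℚ ev).natDegree * j * m + Module.finrank ℂ ↥(algebraicClasses S 1) ≠ 22 := by
    intro j m hj hm
    rw [hdeg, hρ]
    exact four_mul_mul_add_two_ne hj hm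
  rcases generatedBy_or_hasComplexMultiplication_of_eigenvalue_natDegree hmark hS hk e he_rat he_typ
      ⟨σ₀, ev, hσ₀, hσ₀ne, heσ₀, rfl⟩ with hgen | hCM
  · exact hgen
  · exact absurd hCM (not_hasComplexMultiplication_of_picard_two_of_totallyReal_quartic hmark hS hρ e he_rat he_typ
      ⟨σ₀, ev, hσ₀, hσ₀ne, heσ₀, hdeg, htr⟩)

/-- **`IsCycleInducedRMK3 S 2 P`** from one cycle-induced endomorphism with a totally real quartic eigenvalue annihilated on
`T(S)` by `P` (van Geemen–Schütt's quartic shape, Thm. 3.19). [cite: GeemenSchutt2023, §1, §2.1 and Thm. 3.19] -/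
theorem isCycleInducedRMK3_two_of_totallyReal_quartic_cycle (hmark : Huybrechts_K3_marking_exists) (hS : IsK3Surface S)
    (hρ : Module.finrank ℂ ↥(algebraicClasses S 1) = 2)
    (e : complexBetti S (2 * 1) →ₗ[ℂ] complexBetti S (2 * 1))
    (he : IsCycleInducedTranscendentalEndomorphism S hS.isSmoothProjective e)
    (he_ev : ∃ (σ₀ : complexBetti S (2 * 1)) (ev : ℂ), IsOfHodgeType 2 S (2 * 1) 2 0 σ₀ ∧ σ₀ ≠ 0 ∧
      e σ₀ = ev • σ₀ ∧ (minpoly ℚ ev).natDegree = 4 ∧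
      ∀ z : ℂ, Polynomial.aeval z (minpoly ℚ ev) = 0 → starRingEnd ℂ z = z)
    {P : ℚ[X]} (hP : IsAnnihilatedOnTranscendentalBy S e P) : IsCycleInducedRMK3 S 2 P :=
  ⟨hS, hρ, not_hasComplexMultiplication_of_picard_two_of_totallyReal_quartic hmark hS hρ e he.1 he.2.1 he_ev, e, he, hP,
    transcendentalEndomorphismsGeneratedBy_of_picard_two_of_totallyReal_quartic hmark hS hρ e he.1 he.2.1 he_ev⟩

/-- **(c₁) HC⁴(S ⊗ S) at `ρ(S) = 2` from ONE cycle-induced endomorphism with a totally real quartic eigenvalue** (markings;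
F4 `squareOfGenerator` + (b)). [cite: GeemenSchutt2023, §4.8 and Rem. 4.9] [cite: Varesco2023, §2 (p. 8)] -/
theorem hodgeConjectureFor_square_of_totallyReal_quartic_cycle_picard_two (hmark : Huybrechts_K3_marking_exists)
    (hS : IsK3Surface S) (hρ : Module.finrank ℂ ↥(algebraicClasses S 1) = 2)
    (e : complexBetti S (2 * 1) →ₗ[ℂ] complexBetti S (2 * 1))
    (he_rat : ∀ y, IsRationalClass y → IsRationalClass (e y))
    (he_typ : ∀ (i j : ℕ) y, IsOfHodgeType 2 S (2 * 1) i j y → IsOfHodgeType 2 S (2 * 1) i j (e y))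
    (he_N : ∀ d ∈ algebraicClasses S 1, e d = 0)
    (he_cyc : ∃ γ ∈ algebraicClasses (S ⊗ S) 2, ∀ y : complexBetti S (2 * 1), e y = Corr[hS.isSmoothProjective ; γ, y])
    (he_ev : ∃ (σ₀ : complexBetti S (2 * 1)) (ev : ℂ), IsOfHodgeType 2 S (2 * 1) 2 0 σ₀ ∧ σ₀ ≠ 0 ∧
      e σ₀ = ev • σ₀ ∧ (minpoly ℚ ev).natDegree = 4 ∧
      ∀ z : ℂ, Polynomial.aeval z (minpoly ℚ ev) = 0 → starRingEnd ℂ z = z) :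
    HodgeConjectureFor 4 (S ⊗ S) :=
  SquareOfGenerator.squareOfGenerator S hS.isSmoothProjective e he_rat he_N he_cyc
    (transcendentalEndomorphismsGeneratedBy_of_picard_two_of_totallyReal_quartic hmark hS hρ e he_rat he_typ he_ev)

/-- **(c₂) HC⁴ for EVERY HILBERT SQUARE `H = S^{[2]}`** of a projective K3 surface with `ρ(S) = 2` carrying one
cycle-induced transcendental endomorphism with a totally real quartic eigenvalue (the cell-`(3,4)` fourfolds), via the
spread family of `nonempty_rmSpreadFamily_of_exists_algebraicClass` and `hodgeConjectureFor_hilbertSquare_of_rmSpreadFamily`.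
Mod {markings, Beauville}. [cite: Beauville1983, §6 (e)–(f), p. 766] [cite: GeemenSchutt2023, Thm. 3.19 and §4.8] -/
theorem hodgeConjectureFor_hilbertSquare_of_totallyReal_quartic_cycle_picard_two
    (hBea : Beauville1983_hilbertSquare_blowupDiagonal_surjection) (hmark : Huybrechts_K3_marking_exists)
    (hS : IsK3Surface S) (hρ : Module.finrank ℂ ↥(algebraicClasses S 1) = 2)
    (hHilb : IsHilbertSchemeOfPoints 2 S H Ξ) (hH : IsSmoothProjective 4 H)
    (e : complexBetti S (2 * 1) →ₗ[ℂ] complexBetti S (2 * 1))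
    (he : IsCycleInducedTranscendentalEndomorphism S hS.isSmoothProjective e)
    (he_ev : ∃ (σ₀ : complexBetti S (2 * 1)) (ev : ℂ), IsOfHodgeType 2 S (2 * 1) 2 0 σ₀ ∧ σ₀ ≠ 0 ∧
      e σ₀ = ev • σ₀ ∧ (minpoly ℚ ev).natDegree = 4 ∧
      ∀ z : ℂ, Polynomial.aeval z (minpoly ℚ ev) = 0 → starRingEnd ℂ z = z) :
    HodgeConjectureFor 4 H := by
  obtain ⟨F⟩ := nonempty_rmSpreadFamily_of_exists_algebraicClass hS.isSmoothProjective e he.2.2.2.2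
  exact hodgeConjectureFor_hilbertSquare_of_rmSpreadFamily hBea hS.isSmoothProjective hHilb hH he.1 he.2.2.1
    (transcendentalEndomorphismsGeneratedBy_of_picard_two_of_totallyReal_quartic hmark hS hρ e he.1 he.2.1 he_ev) F

end Summit.HodgeConjecture.HodgeConjecture.Theorems.MarkmanPartnerTransport.QuarticSocket

end
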